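import Literature.AnabelianGeometry.AbsoluteAnabelian.ProSigmaMaximalQuotientKernel
import Mathlib.NumberTheory.Padics.RingHoms
import Mathlib.Topology.Instances.ZMod
import Mathlib.Topology.Algebra.ContinuousMonoidHom
import HarnessLib

/-!
# The kernel of the maximal pro-`Σ` quotient: no continuous characters to finite `Σ`-groups or to `ℤ_pⁿ`

S. Mochizuki, *Topics in Absolute Anabelian Geometry I: Generalities* (2012) [AbsTopI] (lit key
`paper:url-11ac98ba15fc`), Def 1.1 (iii) p. 10 (almost pro-`Σ`-maximal quotients `G ↠ Q`,
`Ker(G ↠ Q) = Ker(N ↠ P)` for the maximal pro-`Σ` quotient `N ↠ P` of a normal open `N ⊆ G`) and Thm 1.7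
(ii) p. 14 ("any almost pro-`p`-maximal quotient `G_k ↠ Q` of `G_k` is elastic"), whose proof (p. 15,
l. 1–3) computes the ranks of the open subgroups of `Q` from those of `G_k`.  PROOF-ONLY sequel to
`ProSigmaMaximalQuotientKernel.lean` (membership hypothesis `hK` for `K = Ker(N ↠ P)`, no definitions):

* `map_eq_one_of_finite_sigma` — every continuous homomorphism from `K` to a finite discrete group of
  `Σ`-integer order is trivial (its kernel is an open normal `Σ`-index subgroup of `K`, hence all of `K`
  by `le_of_isSigmaInteger_relIndex`);
* `padicIntPi_hom_eq_one` — **`Hom_cont(K, ℤ_pⁿ) = 1` for every prime `p ∈ Σ`** (reduce modulo `pᵏ`).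

Combined with abc-iut's `freeProlRank_quotient_subgroupOf_eq_of_forall_hom_eq_one`
(`FreeProlRankQuotientProofs.lean`) this gives `δ¹_p(U/K) = δ¹_p(U)` for the open subgroups `U ⊇ K`,
the rank input of the elasticity criterion for `Q = G/K`.  Classical; nothing here bears on [IUTchIII]
Cor. 3.12.
-/

noncomputable section

open Topology

universe u

namespace Literature.AnabelianGeometry.AbsoluteAnabelian

open Literature.AnabelianGeometry.Anabelioids (IsSigmaInteger)

variable {G : Type u} [Group G] [TopologicalSpace G] [IsTopologicalGroup G] {S : Set ℕ} {K : Subgroup G}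

/-- Corollary: **every continuous homomorphism from `K` to a finite discrete `Σ`-group is trivial.**
[cite: MochizukiAbsTopI2012, Def 1.1 (iii) p.10] -/
theorem map_eq_one_of_finite_sigma [CompactSpace G] [T2Space G] [TotallyDisconnectedSpace G]
    (hK : ∀ x, x ∈ K ↔ ∀ W : Subgroup G, W.Normal → IsOpen (W : Set G) → IsSigmaInteger S W.index → x ∈ W)
    {Q : Type*} [Group Q] [Finite Q] [TopologicalSpace Q] [DiscreteTopology Q]
    (hQ : IsSigmaInteger S (Nat.card Q)) (ψ : K →* Q) (hψ : Continuous ψ) (k : K) : ψ k = 1 := by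
  classical
  -- the kernel of `ψ`, as a subgroup of `G` inside `K`
  let V : Subgroup G := ψ.ker.map K.subtype
  have hVK : V ≤ K := fun x hx => by obtain ⟨y, -, rfl⟩ := hx; exact y.2
  have hVsub : V.subgroupOf K = ψ.ker := by
    ext y
    rw [Subgroup.mem_subgroupOf]
    constructor
    · rintro ⟨z, hz, hzy⟩
      have : z = y := Subtype.ext hzy
      rw [← this]; exact hz
    · intro hy; exact ⟨y, hy, rfl⟩
  have hVn : (V.subgroupOf K).Normal := by rw [hVsub]; infer_instance
  have hVo : IsOpen ((V.subgroupOf K : Subgroup K) : Set K) := by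
    rw [hVsub]
    change IsOpen (ψ ⁻¹' {1})
    exact (isOpen_discrete _).preimage hψ
  have hVS : IsSigmaInteger S (V.relIndex K) := by
    change IsSigmaInteger S (V.subgroupOf K).index
    rw [hVsub, Subgroup.index_ker]
    exact hQ.of_dvd (Subgroup.card_subgroup_dvd_card ψ.range)
  have hle := le_of_isSigmaInteger_relIndex hK hVK hVn hVo hVS
  have hk : (k : G) ∈ V := hle k.2
  have : k ∈ V.subgroupOf K := Subgroup.mem_subgroupOf.mpr hk
  rw [hVsub] at this
  exact this

/-! ### No continuous characters to `ℤ_pⁿ` for `p ∈ Σ` -/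

/-- Reduction modulo `pᵏ`, `ℤ_p → ℤ/pᵏ`, is continuous (fibres are balls of radius `p^{-k}`).
[folklore] -/
private theorem continuous_toZModPow (p : ℕ) [Fact p.Prime] (k : ℕ) :
    Continuous (PadicInt.toZModPow k : ℤ_[p] → ZMod (p ^ k)) := by
  refine ((IsLocallyConstant.iff_isOpen_fiber).mpr fun c => ?_).continuous
  rw [isOpen_iff_mem_nhds]
  intro x hx
  have hx' : PadicInt.toZModPow k x = c := hx
  have hpos : (0 : ℝ) < (p : ℝ) ^ (-(k : ℤ)) :=
    zpow_pos (by exact_mod_cast (Fact.out : p.Prime).pos) _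
  refine Filter.mem_of_superset (Metric.ball_mem_nhds x hpos) fun y hy => ?_
  change PadicInt.toZModPow k y ∈ ({c} : Set (ZMod (p ^ k)))
  rw [Set.mem_singleton_iff, ← hx', ← sub_eq_zero, ← map_sub, ← RingHom.mem_ker,
    PadicInt.ker_toZModPow, ← PadicInt.norm_le_pow_iff_mem_span_pow, ← dist_eq_norm]
  exact (Metric.mem_ball.mp hy).le

/-- **`Hom_cont(K, ℤ_pⁿ) = 1` for `p ∈ Σ`**: every continuous homomorphism from the kernel `K` of the
maximal pro-`Σ` quotient to `ℤ_pⁿ`, `p` a prime IN `Σ`, is trivial — its reductions modulo `pᵏ` are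
continuous homomorphisms to the finite `Σ`-groups `(ℤ/pᵏ)ⁿ`, trivial by `map_eq_one_of_finite_sigma`.
(So `δ¹_p` does not see `K`: `δ¹_p(U/K) = δ¹_p(U)` for open `U ⊇ K`, abc-iut's
`freeProlRank_quotient_subgroupOf_eq_of_forall_hom_eq_one` — the rank computation behind the elasticity
of almost pro-`p`-maximal quotients, [AbsTopI] Thm 1.7 (ii) proof p. 15.)
[cite: MochizukiAbsTopI2012, Thm 1.7 (ii) p.14] -/
theorem padicIntPi_hom_eq_one [CompactSpace G] [T2Space G] [TotallyDisconnectedSpace G]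
    (hK : ∀ x, x ∈ K ↔ ∀ W : Subgroup G, W.Normal → IsOpen (W : Set G) → IsSigmaInteger S W.index → x ∈ W)
    {p : ℕ} [hp : Fact p.Prime] (hpS : p ∈ S) {n : ℕ}
    (ψ : K →ₜ* Multiplicative (Fin n → ℤ_[p])) (x : K) : ψ x = 1 := by
  classical
  apply Multiplicative.toAdd.injective
  funext i
  change Multiplicative.toAdd (ψ x) i = 0
  refine (PadicInt.ext_of_toZModPow).mp fun k => ?_
  rw [map_zero]
  -- reduction modulo `pᵏ` on every coordinate
  let red : Multiplicative (Fin n → ℤ_[p]) →* Multiplicative (Fin n → ZMod (p ^ k)) :=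
    AddMonoidHom.toMultiplicative
      (((PadicInt.toZModPow k : ℤ_[p] →+* ZMod (p ^ k)).toAddMonoidHom).compLeft (Fin n))
  have hred : Continuous red :=
    continuous_ofAdd.comp ((continuous_pi fun j =>
      (continuous_toZModPow p k).comp ((continuous_apply j).comp continuous_toAdd)))
  let φ : K →* Multiplicative (Fin n → ZMod (p ^ k)) := red.comp ψ.toMonoidHom
  have hφ : Continuous φ := hred.comp ψ.continuous
  haveI : NeZero (p ^ k) := ⟨pow_ne_zero _ hp.out.ne_zero⟩
  haveI : Finite (Multiplicative (Fin n → ZMod (p ^ k))) :=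
    Finite.of_equiv (Fin n → ZMod (p ^ k)) Multiplicative.ofAdd
  -- `(ℤ/pᵏ)ⁿ` is a finite `Σ`-group
  have hcard : Nat.card (Multiplicative (Fin n → ZMod (p ^ k))) = (p ^ k) ^ n := by
    have hn : Nat.card (Fin n) = n := by simp
    rw [Nat.card_congr Multiplicative.toAdd, Nat.card_fun, Nat.card_zmod, hn]
  have hQ : IsSigmaInteger S (Nat.card (Multiplicative (Fin n → ZMod (p ^ k)))) := by
    rw [hcard]
    refine ⟨pos_of_ne_zero (pow_ne_zero _ (pow_ne_zero _ hp.out.ne_zero)), fun q hq hqd => ?_⟩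
    have hqp : q = p :=
      (Nat.prime_dvd_prime_iff_eq hq hp.out).mp (hq.dvd_of_dvd_pow (hq.dvd_of_dvd_pow hqd))
    exact hqp ▸ hpS
  have hx1 : φ x = 1 := map_eq_one_of_finite_sigma hK hQ φ hφ x
  have := congrFun (congrArg Multiplicative.toAdd hx1) i
  exact this

end Literature.AnabelianGeometry.AbsoluteAnabelian

end
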